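import Summits.Ventures.YMGap.RobustBall.RobustSlabCentre
import Literature.MathematicalPhysics.QuantumFieldTheory.LatticeGaugeDobrushinPoincare
import Literature.MathematicalPhysics.QuantumLattice.PlaquetteBreathingSelfDuality
import HarnessLib

/-!
# Robust ball (Y2), area-law side, part 2b — vertical range, and the bookkeeping of the sparse peeling

HONEST FRAMING: venture file of the cell `pub-ymgap` (QuantumFields programme), track ROBUST-BALL. Strong-coupling, finite-torus
bookkeeping for a PERTURBED Wilson weight `exp(-Nβ S_W - W)`, `W` bounded measurable (parts 1a/1b: `RobustSlabLaw`,
`RobustSlabDisintegration`).  No area law is concluded in this file (that is `RobustSlabCriterion`); no continuum / mass-gap / Clay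
claim anywhere on this track.

§Locality: the hypothesis (HLoc) `HasVerticalRange W v m` — VERTICAL RANGE `m`: changing the off-slab links outside the window of
`v`-heights `t ± k`, `k < m`, changes `W(glue Q r)` by a `Q`-independent amount — and its consequence `slabLawW_eq_of_window`
(the perturbed slab law only sees the window).  §Peeling (bookkeeping half): the predicate `SeesOnlyAbove` («the matrix factor does
not see the vertical links of the remaining leg heights»), the two elementary steps of the sparse peeling — `absorbB` (regrouping a
vertical link into the matrix factor, `loopObs_succ_eq_absorbB`) and `peelBW` (the perturbed slab average of the top slab factor) —
the constants `peelBound` / `peelCount` with `peelBound a s = N^{2s} ε^{peelCount a s}` and `s ≤ m·peelCount a s + a`, and public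
versions of the tree's private measurability / norm lemmas for legs, vertical links and loop observables.

References: Cao–Nissim–Sheffield arXiv:2509.04688v2 §2 (proof of Thm. 2.3); Durhuus–Fröhlich CMP 75 (1980) Thms. 1.2–1.3.
-/

noncomputable section

open MeasureTheory
open Literature.MathematicalPhysics.QuantumLattice (fundamentalRep continuous_fundamentalRep fundamentalRep_apply)
open Literature.MathematicalPhysics.QuantumFieldTheory
open Literature.MathematicalPhysics.QuantumFieldTheory.DurhuusFrohlich

namespace Summit.Ventures.YMGap.RobustBall

variable {n L N : ℕ}

/-! ### Locality of the perturbed slab laws (vertical range `m`) -/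

section Locality

variable [NeZero L] {W : GaugeConfig (n + 1) L (SU N) → ℝ}


/-- The edge `e` lies in the **window of vertical range `m`** around the slab `{x_v = t}`: it is horizontal, or it is a
vertical edge at a height `t ± k` with `k < m`. [folklore] -/
def InWindow (v : Fin (n + 1)) (t : ZMod L) (m : ℕ) (e : Edge (n + 1) L) : Prop :=
  e.2 ≠ v ∨ ∃ k : ℕ, k < m ∧ (e.1 v = t + k ∨ e.1 v + k = t)

variable (W) in
/-- **Vertical range `m` of the perturbation, seen by the slabs** (hypothesis (HLoc) of the robust Durhuus–Fröhlich criterion):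
for every slab `{x_v = t}`, changing the off-slab links OUTSIDE the window of range `m` changes `W(glue Q r)` by an amount that
does not depend on the slab configuration `Q` — so the perturbed slab law only sees the window.  Satisfied (with `m`) by every
sum of local terms each of whose `v`-directed links lie in at most `m` consecutive `v`-heights. [folklore] -/
def HasVerticalRange (v : Fin (n + 1)) (m : ℕ) : Prop :=
  ∀ (t : ZMod L) (Q : Site n L → SU N) (r r' : {e : Edge (n + 1) L // ¬ IsSlab v t e} → SU N),
    (∀ e, InWindow v t m e.1 → r e = r' e) →
      W (glue v t Q r) - W (glue v t Q r') = W (glue v t (fun _ => 1) r) - W (glue v t (fun _ => 1) r')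

omit [NeZero L] in
/-- The boundary fields of the slab only read horizontal links, hence agree for rests agreeing on the window. [folklore] -/
theorem topField_botField_eq_of_window (v : Fin (n + 1)) (t : ZMod L) (m : ℕ)
    (r r' : {e : Edge (n + 1) L // ¬ IsSlab v t e} → SU N) (h : ∀ e, InWindow v t m e.1 → r e = r' e) :
    topField v t (glue v t (fun _ => (1 : SU N)) r) = topField v t (glue v t (fun _ => 1) r') ∧
      botField v t (glue v t (fun _ => (1 : SU N)) r) = botField v t (glue v t (fun _ => 1) r') := by
  constructor
  · funext e
    have hns : ¬ IsSlab v t (ins v (t + 1) e.1, v.succAbove e.2) := fun h => Fin.succAbove_ne v e.2 h.1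
    simp only [topField, glue_of_not_isSlab v t _ _ hns]
    rw [h ⟨_, hns⟩ (Or.inl (Fin.succAbove_ne v e.2))]
  · funext e
    have hns : ¬ IsSlab v t (ins v t e.1, v.succAbove e.2) := fun h => Fin.succAbove_ne v e.2 h.1
    simp only [botField, glue_of_not_isSlab v t _ _ hns]
    rw [h ⟨_, hns⟩ (Or.inl (Fin.succAbove_ne v e.2))]

/-- **The perturbed slab law only sees the window**: under (HLoc), rests agreeing on the window of range `m` give the same
perturbed slab law. [folklore] -/
theorem slabLawW_eq_of_window (v : Fin (n + 1)) {m : ℕ} (hloc : HasVerticalRange W v m) (t : ZMod L) (β : ℝ)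
    (r r' : {e : Edge (n + 1) L // ¬ IsSlab v t e} → SU N) (h : ∀ e, InWindow v t m e.1 → r e = r' e) :
    slabLawW v t β W r = slabLawW v t β W r' := by
  obtain ⟨htop, hbot⟩ := topField_botField_eq_of_window v t m r r' h
  set c : ℝ := W (glue v t (fun _ => 1) r') - W (glue v t (fun _ => 1) r) with hc
  have htilt : slabTiltW v t β W r = fun Q => c + slabTiltW v t β W r' Q := by
    funext Q
    have hW := hloc t Q r r' h
    rw [slabTiltW, slabTiltW, slabActionOf_glue, slabActionOf_glue, htop, hbot, hc]
    linarith
  rw [slabLawW, slabLawW, htilt, tilted_const_add_eq]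

end Locality

/-! ### The sparse peeling: steps and constants -/

/-! ### The sparse peeling induction -/

section Peeling

variable [NeZero L] {W : GaugeConfig (n + 1) L (SU N) → ℝ}


/-- The matrix factor `B` **does not see the vertical links of the slabs at heights `t₀, …, t₀ + s - 1`** (the remaining leg
heights): it takes the same value on configurations agreeing off those links. [folklore] -/
def SeesOnlyAbove (v : Fin (n + 1)) (t₀ : ZMod L) (s : ℕ)
    (B : GaugeConfig (n + 1) L (SU N) → Matrix (Fin N) (Fin N) ℂ) : Prop :=
  ∀ U U' : GaugeConfig (n + 1) L (SU N),
    (∀ e, (¬ ∃ k : ℕ, k < s ∧ IsSlab v (t₀ + (k : ZMod L)) e) → U e = U' e) → B U = B U'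

omit [NeZero L] in
/-- A horizontal factor sees no vertical link at all. [folklore] -/
theorem IsHorizontal.seesOnlyAbove {v : Fin (n + 1)} {B : GaugeConfig (n + 1) L (SU N) → Matrix (Fin N) (Fin N) ℂ}
    (hB : IsHorizontal v B) (t₀ : ZMod L) (s : ℕ) : SeesOnlyAbove v t₀ s B := by
  intro U U' h
  refine hB U U' fun e he => h e ?_
  rintro ⟨k, -, hk⟩
  exact he hk.1

omit [NeZero L] in
/-- Monotonicity: seeing nothing below height `t₀ + s` implies seeing nothing below `t₀ + s'` for `s' ≤ s`. [folklore] -/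
theorem SeesOnlyAbove.mono {v : Fin (n + 1)} {t₀ : ZMod L} {s s' : ℕ}
    {B : GaugeConfig (n + 1) L (SU N) → Matrix (Fin N) (Fin N) ℂ} (hB : SeesOnlyAbove v t₀ s B) (hs : s' ≤ s) :
    SeesOnlyAbove v t₀ s' B := by
  intro U U' h
  refine hB U U' fun e he => h e ?_
  rintro ⟨k, hk, hke⟩
  exact he ⟨k, lt_of_lt_of_le hk hs, hke⟩

/-- **ABSORBING a vertical link into the matrix factor**: `B ↦ Q_p(t₀+s) · B · Q_{p'}(t₀+s)^*`. [folklore] -/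
def absorbB (v : Fin (n + 1)) (t₀ : ZMod L) (p p' : Site n L) (s : ℕ)
    (B : GaugeConfig (n + 1) L (SU N) → Matrix (Fin N) (Fin N) ℂ) (U : GaugeConfig (n + 1) L (SU N)) :
    Matrix (Fin N) (Fin N) ℂ :=
  ((vlink v t₀ p s U : SU N) : Matrix (Fin N) (Fin N) ℂ) * B U * star ((vlink v t₀ p' s U : SU N) : Matrix (Fin N) (Fin N) ℂ)

omit [NeZero L] in
/-- Regrouping the loop observable around the top vertical links: `loopObs_{s+1}(A, B) = loopObs_s(A, absorbB_s B)`. [folklore] -/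
theorem loopObs_succ_eq_absorbB (v : Fin (n + 1)) (t₀ : ZMod L) (p p' : Site n L) (s : ℕ)
    (A B : GaugeConfig (n + 1) L (SU N) → Matrix (Fin N) (Fin N) ℂ) (U : GaugeConfig (n + 1) L (SU N)) :
    loopObs v t₀ p p' (s + 1) A B U = loopObs v t₀ p p' s A (absorbB v t₀ p p' s B) U := by
  simp only [loopObs, absorbB, leg, Submonoid.coe_mul, star_mul, mul_assoc]

/-- **INTEGRATING the top slab**: the slab-averaged factor `B̃(U)_{bc} = E^W_{slab t₀+s, rest(U)}[(Q_p B Q_{p'}^*)_{bc}]`. [folklore] -/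
def peelBW (v : Fin (n + 1)) (t₀ : ZMod L) (p p' : Site n L) (s : ℕ) (β : ℝ)
    (W : GaugeConfig (n + 1) L (SU N) → ℝ) (B : GaugeConfig (n + 1) L (SU N) → Matrix (Fin N) (Fin N) ℂ)
    (U : GaugeConfig (n + 1) L (SU N)) : Matrix (Fin N) (Fin N) ℂ :=
  Matrix.of fun b c => slabAvgW v (t₀ + (s : ZMod L)) β W (slabFactor v t₀ p p' s B (b, c)) (restPart v (t₀ + (s : ZMod L)) U)

/-- Entries of the slab-averaged factor. [folklore] -/
theorem peelBW_apply (v : Fin (n + 1)) (t₀ : ZMod L) (p p' : Site n L) (s : ℕ) (β : ℝ)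
    (B : GaugeConfig (n + 1) L (SU N) → Matrix (Fin N) (Fin N) ℂ) (U : GaugeConfig (n + 1) L (SU N)) (b c : Fin N) :
    peelBW v t₀ p p' s β W B U b c =
      slabAvgW v (t₀ + (s : ZMod L)) β W (slabFactor v t₀ p p' s B (b, c)) (restPart v (t₀ + (s : ZMod L)) U) := by
  simp only [peelBW, Matrix.of_apply]

/-- The bookkeeping constant of the sparse peeling: from the state «`a` more absorptions before the next integration, `s` legs
left», each integration contributes `N²ε`, each absorption `N²`. [folklore] -/
def peelBound (N m : ℕ) (ε : ℝ) : ℕ → ℕ → ℝ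
  | _, 0 => 1
  | 0, s + 1 => (N : ℝ) ^ 2 * ε * peelBound N m ε (m - 1) s
  | a + 1, s + 1 => (N : ℝ) ^ 2 * peelBound N m ε a s

/-- The number of integrations performed from the state `(a, s)`. [folklore] -/
def peelCount (m : ℕ) : ℕ → ℕ → ℕ
  | _, 0 => 0
  | 0, s + 1 => peelCount m (m - 1) s + 1
  | a + 1, s + 1 => peelCount m a s

/-- Closed form: `peelBound a s = N^{2s} ε^{peelCount a s}`. [folklore] -/
theorem peelBound_eq (N m : ℕ) (ε : ℝ) : ∀ s a, peelBound N m ε a s = ((N : ℝ) ^ 2) ^ s * ε ^ peelCount m a s := by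
  intro s
  induction s with
  | zero => intro a; simp [peelBound, peelCount]
  | succ s ih =>
    intro a
    cases a with
    | zero => rw [peelBound, peelCount, ih, pow_succ, pow_succ]; ring
    | succ a => rw [peelBound, peelCount, ih, pow_succ]; ring

/-- `peelBound` is non-negative for `ε ≥ 0`. [folklore] -/
theorem peelBound_nonneg (N m : ℕ) {ε : ℝ} (hε : 0 ≤ ε) (a s : ℕ) : 0 ≤ peelBound N m ε a s := by
  rw [peelBound_eq]; positivity

/-- **At least one integration per `m` processed links**: `s ≤ m · peelCount a s + a` for `a < m` (so from the initial state
`a = 0`: `peelCount 0 T ≥ T/m`, and `≥ 1` as soon as `T ≥ 1`). [folklore] -/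
theorem le_mul_peelCount (m : ℕ) : ∀ s a, a < m → s ≤ m * peelCount m a s + a := by
  intro s
  induction s with
  | zero => intro a _; simp [peelCount]
  | succ s ih =>
    intro a ha
    cases a with
    | zero =>
      rw [peelCount, Nat.mul_add, mul_one]
      have := ih (m - 1) (by omega)
      omega
    | succ a =>
      rw [peelCount]
      have := ih a (by omega)
      omega

omit [NeZero L] in
/-- The leg does not see the links off its own vertical line (public version of the tree's). [folklore] -/
theorem leg_congr' (v : Fin (n + 1)) (t₀ : ZMod L) (p : Site n L) {U U' : GaugeConfig (n + 1) L (SU N)} :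
    ∀ T : ℕ, (∀ s : ℕ, s < T → U (ins v (t₀ + s) p, v) = U' (ins v (t₀ + s) p, v)) →
      leg v t₀ p T U = leg v t₀ p T U'
  | 0, _ => rfl
  | T + 1, h => by
      show leg v t₀ p T U * vlink v t₀ p T U = leg v t₀ p T U' * vlink v t₀ p T U'
      rw [leg_congr' v t₀ p T fun s hs => h s (Nat.lt_succ_of_lt hs), vlink, vlink, h T (Nat.lt_succ_self T)]

omit [NeZero L] in
/-- The first `s` links of a leg are not vertical links of the slab at height `t₀ + s` (`s < L`). [folklore] -/
theorem leg_glue' (v : Fin (n + 1)) (t₀ : ZMod L) (p : Site n L) {s : ℕ} (hs : s < L)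
    (Q Q' : Site n L → SU N) (r : {e : Edge (n + 1) L // ¬ IsSlab v (t₀ + (s : ZMod L)) e} → SU N) :
    leg v t₀ p s (glue v (t₀ + (s : ZMod L)) Q r) = leg v t₀ p s (glue v (t₀ + (s : ZMod L)) Q' r) := by
  refine leg_congr' v t₀ p s fun k hk => ?_
  have hns : ¬ IsSlab v (t₀ + (s : ZMod L)) (ins v (t₀ + (k : ZMod L)) p, v) := by
    rintro ⟨-, h⟩
    have h' : t₀ + (k : ZMod L) = t₀ + (s : ZMod L) := by simpa [ins] using h
    exact (ne_of_lt hk) (Literature.MathematicalPhysics.QuantumLattice.nat_eq_of_zmod_cast_eq (hk.trans hs) hs (add_left_cancel h'))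
  rw [glue_of_not_isSlab _ _ _ _ hns, glue_of_not_isSlab _ _ _ _ hns]

omit [NeZero L] in
/-- The vertical link of a glued configuration is the slab spin. [folklore] -/
theorem vlink_glue' (v : Fin (n + 1)) (t₀ : ZMod L) (p : Site n L) (s : ℕ) (Q : Site n L → SU N)
    (r : {e : Edge (n + 1) L // ¬ IsSlab v (t₀ + (s : ZMod L)) e} → SU N) :
    vlink v t₀ p s (glue v (t₀ + (s : ZMod L)) Q r) = Q p := by
  rw [vlink, glue_ins]

omit [NeZero L] in
/-- `tr(M₁ M₂ M₃) = Σ_{a,b,c} (M₁)_{ab} (M₂)_{bc} (M₃)_{ca}`. [folklore] -/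
theorem trace_mul_mul_eq_sum' (M₁ M₂ M₃ : Matrix (Fin N) (Fin N) ℂ) :
    (M₁ * M₂ * M₃).trace = ∑ τ : Fin N × Fin N × Fin N, M₁ τ.1 τ.2.1 * M₂ τ.2.1 τ.2.2 * M₃ τ.2.2 τ.1 := by
  simp only [Matrix.trace, Matrix.diag, Matrix.mul_apply, Finset.sum_mul, Fintype.sum_prod_type]
  exact Finset.sum_congr rfl fun a _ => Finset.sum_comm

/-- Integrability of bounded measurable observables against the perturbed weight. [folklore] -/
theorem integrable_weightW_mul (β : ℝ) (hWm : Measurable W) (hWb : ∃ C, ∀ U, |W U| ≤ C)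
    {F : GaugeConfig (n + 1) L (SU N) → ℂ} (hF : Measurable F) {C : ℝ}
    (hC : ∀ U, ‖F U‖ ≤ C) : Integrable (fun U => (weightW N β W U : ℂ) * F U) (linkMeasure n L N) := by
  obtain ⟨Cw, hCw⟩ := exists_weightW_le (n := n) (L := L) (N := N) β hWb
  refine Integrable.of_bound ?_ (Cw * C) (ae_of_all _ fun U => ?_)
  · exact ((Complex.measurable_ofReal.comp (measurable_weightW β hWm)).mul hF).aestronglyMeasurable
  · rw [norm_mul, Complex.norm_real, Real.norm_eq_abs, abs_of_pos (weightW_pos W β _)]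
    exact mul_le_mul (hCw _) (hC _) (norm_nonneg _) ((weightW_pos W β U).le.trans (hCw U))

omit [NeZero L] in
/-- Entries of a product of two entrywise-measurable matrix observables are measurable. [folklore] -/
theorem measurable_mul_entry' {M₁ M₂ : GaugeConfig (n + 1) L (SU N) → Matrix (Fin N) (Fin N) ℂ}
    (h₁ : ∀ a b, Measurable fun U => M₁ U a b) (h₂ : ∀ a b, Measurable fun U => M₂ U a b) (a b : Fin N) :
    Measurable fun U => (M₁ U * M₂ U) a b := by
  simp only [Matrix.mul_apply]
  exact Finset.measurable_sum _ fun k _ => (h₁ a k).mul (h₂ k b)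

omit [NeZero L] in
/-- Entries of a product: `|(M₁M₂)_{ab}| ≤ N K₁ K₂`. [folklore] -/
theorem norm_mul_entry_le' {M₁ M₂ : Matrix (Fin N) (Fin N) ℂ} {K₁ K₂ : ℝ} (h₁ : ∀ a b, ‖M₁ a b‖ ≤ K₁)
    (h₂ : ∀ a b, ‖M₂ a b‖ ≤ K₂) (a b : Fin N) : ‖(M₁ * M₂) a b‖ ≤ N * (K₁ * K₂) := by
  rw [Matrix.mul_apply]
  have hK₁ : 0 ≤ K₁ := (norm_nonneg _).trans (h₁ a a)
  calc ‖∑ k, M₁ a k * M₂ k b‖ ≤ ∑ k, ‖M₁ a k * M₂ k b‖ := norm_sum_le _ _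
    _ ≤ ∑ _k : Fin N, K₁ * K₂ := Finset.sum_le_sum fun k _ => by
        rw [norm_mul]; exact mul_le_mul (h₁ a k) (h₂ k b) (norm_nonneg _) hK₁
    _ = N * (K₁ * K₂) := by simp

omit [NeZero L] in
/-- The leg is continuous in the configuration. [folklore] -/
theorem continuous_leg' (v : Fin (n + 1)) (t₀ : ZMod L) (p : Site n L) : ∀ T : ℕ, Continuous (leg (N := N) v t₀ p T)
  | 0 => continuous_const
  | T + 1 => (continuous_leg' v t₀ p T).mul (continuous_apply _)

/-- Matrix entries of a leg are measurable. [folklore] -/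
theorem measurable_coe_leg_entry' (v : Fin (n + 1)) (t₀ : ZMod L) (p : Site n L) (T : ℕ) (a b : Fin N) :
    Measurable fun U : GaugeConfig (n + 1) L (SU N) => ((leg v t₀ p T U : SU N) : Matrix (Fin N) (Fin N) ℂ) a b :=
  ((continuous_subtype_val.comp (continuous_leg' v t₀ p T)).matrix_elem a b).measurable

/-- Matrix entries of the adjoint of a leg are measurable. [folklore] -/
theorem measurable_star_coe_leg_entry' (v : Fin (n + 1)) (t₀ : ZMod L) (p : Site n L) (T : ℕ) (a b : Fin N) :
    Measurable fun U : GaugeConfig (n + 1) L (SU N) =>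
      (star ((leg v t₀ p T U : SU N) : Matrix (Fin N) (Fin N) ℂ)) a b :=
  ((continuous_subtype_val.comp (continuous_leg' v t₀ p T)).star.matrix_elem a b).measurable

omit [NeZero L] in
/-- Entries of the adjoint of an `SU(N)` matrix have norm `≤ 1`. [folklore] -/
theorem norm_star_entry_le' (g : SU N) (a b : Fin N) : ‖(star (g : Matrix (Fin N) (Fin N) ℂ)) a b‖ ≤ 1 := by
  rw [Matrix.star_apply, Complex.star_def, Complex.norm_conj]
  exact norm_entry_le g b a

/-- Matrix entries of a vertical link are measurable. [folklore] -/
theorem measurable_vlink_entry' (v : Fin (n + 1)) (t₀ : ZMod L) (p : Site n L) (T : ℕ) (a b : Fin N) :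
    Measurable fun U : GaugeConfig (n + 1) L (SU N) => ((vlink v t₀ p T U : SU N) : Matrix (Fin N) (Fin N) ℂ) a b :=
  ((continuous_subtype_val.comp (continuous_apply _)).matrix_elem a b).measurable

/-- Matrix entries of the adjoint of a vertical link are measurable. [folklore] -/
theorem measurable_star_vlink_entry' (v : Fin (n + 1)) (t₀ : ZMod L) (p : Site n L) (T : ℕ) (a b : Fin N) :
    Measurable fun U : GaugeConfig (n + 1) L (SU N) =>
      (star ((vlink v t₀ p T U : SU N) : Matrix (Fin N) (Fin N) ℂ)) a b :=
  ((continuous_subtype_val.comp (continuous_apply _)).star.matrix_elem a b).measurable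

/-- The leg factor is measurable. [folklore] -/
theorem measurable_legFactor' (v : Fin (n + 1)) (t₀ : ZMod L) (p p' : Site n L) (T : ℕ)
    {A : GaugeConfig (n + 1) L (SU N) → Matrix (Fin N) (Fin N) ℂ} (hAm : ∀ a b, Measurable fun U => A U a b)
    (τ : Fin N × Fin N × Fin N) : Measurable (legFactor v t₀ p p' T A τ) :=
  (measurable_mul_entry' hAm (measurable_coe_leg_entry' v t₀ p T) τ.1 τ.2.1).mul
    (measurable_star_coe_leg_entry' v t₀ p' T τ.2.2 τ.1)

omit [NeZero L] in
/-- The leg factor is bounded by `N`. [folklore] -/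
theorem norm_legFactor_le' (v : Fin (n + 1)) (t₀ : ZMod L) (p p' : Site n L) (T : ℕ)
    {A : GaugeConfig (n + 1) L (SU N) → Matrix (Fin N) (Fin N) ℂ} (hA : ∀ U a b, ‖A U a b‖ ≤ 1)
    (τ : Fin N × Fin N × Fin N) (U : GaugeConfig (n + 1) L (SU N)) : ‖legFactor v t₀ p p' T A τ U‖ ≤ N := by
  rw [legFactor, norm_mul]
  have h1 := norm_mul_entry_le' (hA U) (fun a b => norm_entry_le (leg v t₀ p T U) a b) τ.1 τ.2.1
  have h2 := norm_star_entry_le' (leg v t₀ p' T U) τ.2.2 τ.1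
  calc _ ≤ (N : ℝ) * (1 * 1) * 1 := mul_le_mul h1 h2 (norm_nonneg _) (by positivity)
    _ = N := by ring

/-- The slab factor is measurable. [folklore] -/
theorem measurable_slabFactor' (v : Fin (n + 1)) (t₀ : ZMod L) (p p' : Site n L) (T : ℕ)
    {B : GaugeConfig (n + 1) L (SU N) → Matrix (Fin N) (Fin N) ℂ} (hBm : ∀ a b, Measurable fun U => B U a b)
    (bc : Fin N × Fin N) : Measurable (slabFactor v t₀ p p' T B bc) :=
  measurable_mul_entry' (measurable_mul_entry' (measurable_vlink_entry' v t₀ p T) hBm)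
    (measurable_star_vlink_entry' v t₀ p' T) bc.1 bc.2

omit [NeZero L] in
/-- The slab factor is bounded by `N²K`. [folklore] -/
theorem norm_slabFactor_le' (v : Fin (n + 1)) (t₀ : ZMod L) (p p' : Site n L) (T : ℕ)
    {B : GaugeConfig (n + 1) L (SU N) → Matrix (Fin N) (Fin N) ℂ} {K : ℝ} (hB : ∀ U a b, ‖B U a b‖ ≤ K)
    (bc : Fin N × Fin N) (U : GaugeConfig (n + 1) L (SU N)) :
    ‖slabFactor v t₀ p p' T B bc U‖ ≤ (N : ℝ) * ((N : ℝ) * (1 * K) * 1) :=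
  norm_mul_entry_le' (norm_mul_entry_le' (fun a b => norm_entry_le _ a b) (hB U))
    (fun a b => norm_star_entry_le' _ a b) bc.1 bc.2

omit [NeZero L] in
/-- The loop observable expanded around `B` (public version). [folklore] -/
theorem loopObs_eq_sum' (v : Fin (n + 1)) (t₀ : ZMod L) (p p' : Site n L) (T : ℕ)
    (A B : GaugeConfig (n + 1) L (SU N) → Matrix (Fin N) (Fin N) ℂ) (U : GaugeConfig (n + 1) L (SU N)) :
    loopObs v t₀ p p' T A B U =
      ∑ τ : Fin N × Fin N × Fin N, legFactor v t₀ p p' T A τ U * B U τ.2.1 τ.2.2 := by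
  rw [loopObs, trace_mul_mul_eq_sum']
  exact Finset.sum_congr rfl fun τ _ => by simp only [legFactor]; ring

omit [NeZero L] in
/-- The loop observable with one more slab, regrouped around the top slab (public version). [folklore] -/
theorem loopObs_succ' (v : Fin (n + 1)) (t₀ : ZMod L) (p p' : Site n L) (T : ℕ)
    (A B : GaugeConfig (n + 1) L (SU N) → Matrix (Fin N) (Fin N) ℂ) (U : GaugeConfig (n + 1) L (SU N)) :
    loopObs v t₀ p p' (T + 1) A B U =
      ∑ τ : Fin N × Fin N × Fin N, legFactor v t₀ p p' T A τ U * slabFactor v t₀ p p' T B (τ.2.1, τ.2.2) U := by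
  rw [loopObs_succ_eq_absorbB, loopObs_eq_sum']
  exact Finset.sum_congr rfl fun τ _ => by simp only [absorbB, slabFactor]

/-- The loop observable is measurable (entrywise-measurable `A`, `B`). [folklore] -/
theorem measurable_loopObs (v : Fin (n + 1)) (t₀ : ZMod L) (p p' : Site n L) (T : ℕ)
    {A B : GaugeConfig (n + 1) L (SU N) → Matrix (Fin N) (Fin N) ℂ} (hAm : ∀ a b, Measurable fun U => A U a b)
    (hBm : ∀ a b, Measurable fun U => B U a b) : Measurable (loopObs v t₀ p p' T A B) := by
  have : loopObs v t₀ p p' T A B = fun U => ∑ τ : Fin N × Fin N × Fin N,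
      legFactor v t₀ p p' T A τ U * B U τ.2.1 τ.2.2 := funext fun U => loopObs_eq_sum' v t₀ p p' T A B U
  rw [this]
  exact Finset.measurable_sum _ fun τ _ => (measurable_legFactor' v t₀ p p' T hAm τ).mul (hBm _ _)

omit [NeZero L] in
/-- The loop observable is bounded by `N³K` (entries of `A` ≤ 1, of `B` ≤ K). [folklore] -/
theorem norm_loopObs_le (v : Fin (n + 1)) (t₀ : ZMod L) (p p' : Site n L) (T : ℕ)
    {A B : GaugeConfig (n + 1) L (SU N) → Matrix (Fin N) (Fin N) ℂ} {K : ℝ} (hA : ∀ U a b, ‖A U a b‖ ≤ 1)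
    (hB : ∀ U a b, ‖B U a b‖ ≤ K) (U : GaugeConfig (n + 1) L (SU N)) :
    ‖loopObs v t₀ p p' T A B U‖ ≤ (N : ℝ) ^ 3 * (N * K) := by
  rw [loopObs_eq_sum']
  calc _ ≤ ∑ τ : Fin N × Fin N × Fin N, ‖legFactor v t₀ p p' T A τ U * B U τ.2.1 τ.2.2‖ := norm_sum_le _ _
    _ ≤ ∑ _τ : Fin N × Fin N × Fin N, (N : ℝ) * K := Finset.sum_le_sum fun τ _ => by
        rw [norm_mul]
        exact mul_le_mul (norm_legFactor_le' v t₀ p p' T hA τ U) (hB _ _ _) (norm_nonneg _) (Nat.cast_nonneg _)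
    _ = (N : ℝ) ^ 3 * (N * K) := by
        rw [Finset.sum_const, Finset.card_univ, nsmul_eq_mul]
        simp only [Fintype.card_prod, Fintype.card_fin, Nat.cast_mul]
        ring

end Peeling

end Summit.Ventures.YMGap.RobustBall
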